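import Literature.NumberTheory.EllipticCurves.BhargavaShankarSolubleOrbits
import HarnessLib

/-!
# Bhargava–Shankar, Lemma 5.10: the identity class — `f_P ∼ f_O` iff `P ∈ 2E(K)`

Topic `Literature/NumberTheory/EllipticCurves`; sequel to `BhargavaShankarSolubleOrbits.lean`
(the `2`-covering map, the normal forms `f_P = BinaryQuartic.quarticOfPoint I ξ η` and
`f_O = BinaryQuartic.trivialQuartic I J` of `K`-soluble binary quartic forms with invariants
`(I, J)`, and the fact that their `PGL₂(K)`-classes exhaust the `K`-soluble classes).

Source: M. Bhargava, A. Shankar, *Binary quartic forms having bounded invariants, and the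
boundedness of the average rank of elliptic curves*, Ann. of Math. (2) 181 (2015) 191–242,
Lemma 5.10 of the held arXiv text `arXiv:1006.1002v2` (= Thm 3.2 of the published version): the map
`Q_E : E(K)/2E(K) → {K-classes of quartics}` "is injective and the image consists exactly of the
`K`-soluble `K`-equivalence classes of quartics having invariants equal to `I` and `J`". With the
explicit representatives `Q_E(P) = [f_P]`, `Q_E(O) = [f_O]` of the companion file, injectivity and
well-definedness of `Q_E` amount to: `f_P ∼ f_Q ↔ P − Q ∈ 2E(K)` and `f_P ∼ f_O ↔ P ∈ 2E(K)`
(Cremona 2001, Prop. 4.3 (4): the image of `C_f(K)` under the covering map is a coset of `2E(K)`).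
This file proves the second of these, the description of **the identity class**, over a field of
characteristic `0` and for `4I³ − J² ≠ 0`:

* `BinaryQuartic.pgl2Equiv_trivialQuartic_iff_exists_root`: `f_P ∼ f_O` iff `f_P(x, 1) = 0` for
  some `x ∈ K` (a quartic is equivalent to `f_O = y·(cubic)` iff it has a `K`-rational linear
  factor; `f_P` is monic, so its roots are finite);
* `BinaryQuartic.exists_add_self_eq_of_eval_eq_zero` / `BinaryQuartic.eval_eq_zero_of_add_self_eq`:
  `f_P(x, 1) = 0` for some `x` iff `P = 2R` for some `R ∈ E_{I,J}(K)`. Explicitly: a root `x`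
  yields `R = (2x² − ξ/2, −(4x³ − 3ξx + η))` with `2R = P` (the tangent slope at `R` being `−2x`),
  and conversely if `2R = P` with tangent slope `λ` at `R` then `x = −λ/2` is a root of `f_P(x,1)`;
* hence `BinaryQuartic.pgl2Equiv_trivialQuartic_iff_exists_add_self_eq` and, in the form used by
  the local masses of Prop. 5.12 (`Literature.NumberTheory.EllipticCurves.localSelmerRatio`),
  `BinaryQuartic.pgl2Equiv_trivialQuartic_iff_mem_range_two`:
  **`f_P` is `PGL₂(K)`-equivalent to `f_O` iff `P ∈ 2E_{I,J}(K)`**.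

On the way: the doubling formula on `E_{I,J}` in the shape needed (`add_self_eq_of_slope`).

## References

* M. Bhargava, A. Shankar, Ann. of Math. (2) 181 (2015) 191–242, Lemma 5.10 (arXiv:1006.1002v2
  numbering; Thm 3.2 of the published version). [cite: BhargavaShankarAnnals2015, Lemma 5.10 (arXiv:1006.1002v2 numbering)]
* J. E. Cremona, *Classical invariants and 2-descent on elliptic curves*, J. Symbolic Comput. 31
  (2001) 71–87, Prop. 4.2, Prop. 4.3 (1), (4) (`ξ = [2] ∘ θ`; the image of `C(K)` is a coset of
  `2E(K)`). [cite: Cremona2001, Prop. 4.3]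

## Design

Characteristic `0` throughout, as in the companion file. Points of `E_{I,J}(K)` are Mathlib's
`(curveOfInvariants K I J).toAffine.Point`; "`P ∈ 2E(K)`" is stated both as `∃ R, R + R = P` and
as membership in the range of `zsmulAddGroupHom 2`, the form appearing in `localSelmerRatio`.
-/

noncomputable section

open scoped Classical
open Matrix

namespace Literature.NumberTheory.EllipticCurves

namespace BinaryQuartic

variable {K : Type*} [Field K] [CharZero K]

/-! ## The curve `E_{I,J}`: negation and doubling -/

omit [CharZero K] in
/-- On `E_{I,J}` (`a₁ = a₃ = 0`) the negative of `(x, y)` is `(x, −y)`. [folklore] -/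
theorem curveOfInvariants_negY (I J x y : K) : (curveOfInvariants K I J).toAffine.negY x y = -y := by
  simp only [WeierstrassCurve.Affine.negY, curveOfInvariants]
  ring

/-- Off the discriminant locus, a point of `E_{I,J}` is nonsingular as soon as it is on the curve. [folklore] -/
theorem curveOfInvariants_nonsingular_of_equation {I J : K} (hΔ : 4 * I ^ 3 - J ^ 2 ≠ 0) {x y : K}
    (h : (curveOfInvariants K I J).toAffine.Equation x y) :
    (curveOfInvariants K I J).toAffine.Nonsingular x y := by
  haveI := isElliptic_curveOfInvariants_of_ne hΔ
  exact WeierstrassCurve.Affine.equation_iff_nonsingular.mp h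

/-- **Doubling on `E_{I,J}`** in the shape used below: if `R = (u, v)` with `v ≠ 0` has tangent slope
`ℓ` (`2vℓ = 3u² − I/3`) and `(ξ, η) = (ℓ² − 2u, ℓ(u − ξ) − v)`, then `R + R = (ξ, η)`. [folklore] -/
theorem add_self_eq_of_slope {I J u v ξ η ℓ : K}
    (hR : (curveOfInvariants K I J).toAffine.Nonsingular u v)
    (hP : (curveOfInvariants K I J).toAffine.Nonsingular ξ η) (hv : v ≠ 0)
    (hℓ : ℓ * (2 * v) = 3 * u ^ 2 - I / 3) (hξ : ξ = ℓ ^ 2 - 2 * u) (hη : η = ℓ * (u - ξ) - v) :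
    (.some _ _ hR : (curveOfInvariants K I J).toAffine.Point) + .some _ _ hR = .some _ _ hP := by
  have h2v : (2 * v : K) ≠ 0 := mul_ne_zero two_ne_zero hv
  have hy : v ≠ (curveOfInvariants K I J).toAffine.negY u v := by
    rw [curveOfInvariants_negY]
    intro h
    apply hv
    linear_combination (1 / 2 : K) * h
  have hden : v - (curveOfInvariants K I J).toAffine.negY u v = 2 * v := by
    rw [curveOfInvariants_negY]; ring
  have hs : (curveOfInvariants K I J).toAffine.slope u u v v = ℓ := by
    rw [WeierstrassCurve.Affine.slope_of_Y_ne rfl hy, hden, div_eq_iff h2v]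
    simp only [curveOfInvariants]
    linear_combination -hℓ
  rw [WeierstrassCurve.Affine.Point.add_self_of_Y_ne hy]
  simp only [WeierstrassCurve.Affine.Point.some.injEq]
  rw [hs]
  refine ⟨?_, ?_⟩
  · simp only [WeierstrassCurve.Affine.addX, curveOfInvariants]
    rw [hξ]; ring
  · simp only [WeierstrassCurve.Affine.addY, WeierstrassCurve.Affine.negAddY,
      WeierstrassCurve.Affine.addX, WeierstrassCurve.Affine.negY, curveOfInvariants]
    rw [hη, hξ]; ring

/-- Conversely, reading off `R + R = P` on `E_{I,J}`: `R` is an affine point `(u, v)` with `v ≠ 0`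
(a `2`-torsion point doubles to `O ≠ P`), and `(ξ, η) = (ℓ² − 2u, ℓ(u − ξ) − v)` with `ℓ` the
tangent slope at `R`. [folklore] -/
theorem exists_slope_of_add_self_eq {I J ξ η : K}
    (hP : (curveOfInvariants K I J).toAffine.Nonsingular ξ η)
    {R : (curveOfInvariants K I J).toAffine.Point} (h2R : R + R = .some _ _ hP) :
    ∃ u v ℓ : K, ∃ hR : (curveOfInvariants K I J).toAffine.Nonsingular u v,
      R = .some _ _ hR ∧ v ≠ 0 ∧ ℓ * (2 * v) = 3 * u ^ 2 - I / 3 ∧ ξ = ℓ ^ 2 - 2 * u ∧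
        η = ℓ * (u - ξ) - v := by
  rcases R with _ | ⟨u, v, hR⟩
  · exact absurd h2R.symm (by
      rw [← WeierstrassCurve.Affine.Point.zero_def, add_zero]
      exact WeierstrassCurve.Affine.Point.some_ne_zero _)
  · have hv : v ≠ 0 := by
      intro hv
      have hy : v = (curveOfInvariants K I J).toAffine.negY u v := by
        rw [curveOfInvariants_negY, hv, neg_zero]
      rw [WeierstrassCurve.Affine.Point.add_self_of_Y_eq hy] at h2R
      exact WeierstrassCurve.Affine.Point.some_ne_zero _ h2R.symm
    have h2v : (2 * v : K) ≠ 0 := mul_ne_zero two_ne_zero hv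
    have hy : v ≠ (curveOfInvariants K I J).toAffine.negY u v := by
      rw [curveOfInvariants_negY]
      intro h
      apply hv
      linear_combination (1 / 2 : K) * h
    have hden : v - (curveOfInvariants K I J).toAffine.negY u v = 2 * v := by
      rw [curveOfInvariants_negY]; ring
    rw [WeierstrassCurve.Affine.Point.add_self_of_Y_ne hy] at h2R
    simp only [WeierstrassCurve.Affine.Point.some.injEq] at h2R
    obtain ⟨hx3, hy3⟩ := h2R
    set ℓ := (curveOfInvariants K I J).toAffine.slope u u v v with hℓdef
    have hℓ : ℓ * (2 * v) = 3 * u ^ 2 - I / 3 := by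
      rw [hℓdef, WeierstrassCurve.Affine.slope_of_Y_ne rfl hy, hden, div_mul_cancel₀ _ h2v]
      simp only [curveOfInvariants]
      ring
    refine ⟨u, v, ℓ, hR, rfl, hv, hℓ, ?_, ?_⟩
    · rw [← hx3]
      simp only [WeierstrassCurve.Affine.addX, curveOfInvariants]
      ring
    · rw [← hy3, ← hx3]
      simp only [WeierstrassCurve.Affine.addY, WeierstrassCurve.Affine.negAddY,
        WeierstrassCurve.Affine.addX, WeierstrassCurve.Affine.negY, curveOfInvariants]
      ring

/-! ## Roots of `f_P(x, 1)` versus halves of `P` -/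

omit [CharZero K] in
/-- `f_P(x, 1) = x⁴ − (3ξ/2)x² + ηx + I/12 − 3ξ²/16`. [cite: BhargavaShankarAnnals2015, Lemma 5.10 (arXiv:1006.1002v2 numbering)] -/
theorem eval_quarticOfPoint_one (I ξ η x : K) :
    (quarticOfPoint I ξ η).eval x 1 = x ^ 4 - 3 / 2 * ξ * x ^ 2 + η * x + (I / 12 - 3 / 16 * ξ ^ 2) := by
  simp only [eval, quarticOfPoint]
  ring

/-- **A `K`-rational root of `f_P(x,1)` halves `P`**: if `f_P(x, 1) = 0` then
`R = (2x² − ξ/2, −(4x³ − 3ξx + η))` is a point of `E_{I,J}(K)` with `R + R = P`; the tangent slope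
at `R` is `−2x`, and `v(R) ≠ 0` because `4I³ − J² ≠ 0` (the root `[x:1]` of `f_P` is the point
`θ(R)` of `C_{f_P}` above `O`, in the notation of Cremona 2001, Prop. 4.3).
[cite: Cremona2001, Prop. 4.3] -/
theorem exists_add_self_eq_of_eval_eq_zero {I J ξ η : K} (hΔ : 4 * I ^ 3 - J ^ 2 ≠ 0)
    (hP : (curveOfInvariants K I J).toAffine.Nonsingular ξ η) {x : K}
    (hx : (quarticOfPoint I ξ η).eval x 1 = 0) :
    ∃ R : (curveOfInvariants K I J).toAffine.Point, R + R = .some _ _ hP := by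
  rw [eval_quarticOfPoint_one] at hx
  have hPE : η ^ 2 = ξ ^ 3 - I / 3 * ξ - J / 27 := (curveOfInvariants_equation_iff I J ξ η).mp hP.1
  set u : K := 2 * x ^ 2 - ξ / 2 with hu
  set v : K := -(4 * x ^ 3 - 3 * ξ * x + η) with hv
  -- `R = (u, v)` lies on `E_{I,J}`
  have hRE : (curveOfInvariants K I J).toAffine.Equation u v := by
    rw [curveOfInvariants_equation_iff, hu, hv]
    linear_combination (8 * x ^ 2 - 6 * ξ) * hx + hPE
  have hR := curveOfInvariants_nonsingular_of_equation hΔ hRE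
  -- `v ≠ 0`: otherwise `4I³ = J²`
  have hv0 : v ≠ 0 := by
    intro hv0
    have hη : η = 3 * ξ * x - 4 * x ^ 3 := by rw [hv] at hv0; linear_combination -hv0
    have hI : I = -12 * x ^ 4 + 18 * ξ * x ^ 2 - 12 * η * x + 9 / 4 * ξ ^ 2 := by
      linear_combination 12 * hx
    have hJ : J = 27 * ξ ^ 3 - 9 * I * ξ - 27 * η ^ 2 := by linear_combination 27 * hPE
    apply hΔ
    rw [hJ, hI, hη]
    ring
  -- the tangent slope at `R` is `−2x`, and doubling gives `P`
  refine ⟨.some _ _ hR, add_self_eq_of_slope hR hP hv0 (ℓ := -2 * x) ?_ ?_ ?_⟩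
  · rw [hu, hv]; linear_combination (4 : K) * hx
  · rw [hu]; ring
  · rw [hu, hv]; ring

/-- **A half of `P` yields a `K`-rational root of `f_P(x,1)`**: if `R + R = P` in `E_{I,J}(K)` and
`ℓ` is the tangent slope at `R`, then `f_P(−ℓ/2, 1) = 0`. [cite: Cremona2001, Prop. 4.3] -/
theorem eval_eq_zero_of_add_self_eq {I J ξ η : K}
    (hP : (curveOfInvariants K I J).toAffine.Nonsingular ξ η)
    {R : (curveOfInvariants K I J).toAffine.Point} (h2R : R + R = .some _ _ hP) :
    ∃ x : K, (quarticOfPoint I ξ η).eval x 1 = 0 := by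
  obtain ⟨u, v, ℓ, hR, rfl, hv, hℓ, hξ, hη⟩ := exists_slope_of_add_self_eq hP h2R
  refine ⟨-ℓ / 2, ?_⟩
  have hI : I = 9 * u ^ 2 - 6 * ℓ * v := by linear_combination 3 * hℓ
  rw [eval_quarticOfPoint_one, hη, hξ, hI]
  ring

/-! ## The identity class -/

/-- `Δ(f_P) ≠ 0` when `P ∈ E_{I,J}` and `4I³ ≠ J²` (`27Δ(f_P) = 4I³ − J²`). [folklore] -/
theorem disc_quarticOfPoint_ne_zero {I J ξ η : K} (hΔ : 4 * I ^ 3 - J ^ 2 ≠ 0)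
    (hPE : (curveOfInvariants K I J).toAffine.Equation ξ η) : (quarticOfPoint I ξ η).disc ≠ 0 := by
  intro h
  have h27 := twentySeven_mul_disc (quarticOfPoint I ξ η)
  rw [h, mul_zero, I_quarticOfPoint, (J_quarticOfPoint_eq_iff I J ξ η).mpr hPE] at h27
  exact hΔ h27.symm

/-- **`f_P ∼ f_O` iff `f_P` has a `K`-rational root.** A quartic with invariants `(I, J)` is
`PGL₂(K)`-equivalent to `f_O = y · (x³ − (I/3)xy² − (J/27)y³)` iff it has a `K`-rational linear
factor; for the monic `f_P` this means `f_P(x, 1) = 0` for some `x ∈ K`. (`⇐` is the normal form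
`exists_twist_eq_trivialQuartic`; `⇒`: `γ · f_P = f_O` has `a = 0`, i.e. `f_P((1,0)γ) = 0`.)
[cite: BhargavaShankarAnnals2015, Lemma 5.10 (arXiv:1006.1002v2 numbering)] -/
theorem pgl2Equiv_trivialQuartic_iff_exists_root {I J ξ η : K} (hΔ : 4 * I ^ 3 - J ^ 2 ≠ 0)
    (hPE : (curveOfInvariants K I J).toAffine.Equation ξ η) :
    PGL2Equiv (quarticOfPoint I ξ η) (trivialQuartic I J) ↔
      ∃ x : K, (quarticOfPoint I ξ η).eval x 1 = 0 := by
  have hIP := I_quarticOfPoint I ξ η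
  have hJP := (J_quarticOfPoint_eq_iff I J ξ η).mpr hPE
  constructor
  · rintro ⟨γ, hγ, hO⟩
    have ha := congrArg BinaryQuartic.a hO
    change (trivialQuartic I J).a = (twist γ (quarticOfPoint I ξ η)).a at ha
    rw [twist_a_eq] at ha
    have h0 : (quarticOfPoint I ξ η).eval (γ 0 0) (γ 0 1) = 0 := by
      have : (trivialQuartic I J).a = 0 := rfl
      rw [this] at ha
      rcases mul_eq_zero.mp ha.symm with h | h
      · exact absurd h (inv_ne_zero (pow_ne_zero 2 hγ))
      · exact h
    have h01 : γ 0 1 ≠ 0 := by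
      intro h01
      have h00 : γ 0 0 = 0 := by
        rw [h01] at h0
        simpa [eval, quarticOfPoint] using h0
      apply hγ
      rw [Matrix.det_fin_two, h00, h01]; ring
    refine ⟨γ 0 0 / γ 0 1, ?_⟩
    have h := eval_smul_smul (quarticOfPoint I ξ η) (γ 0 1)⁻¹ (γ 0 0) (γ 0 1)
    rw [h0, mul_zero, inv_mul_cancel₀ h01] at h
    rwa [div_eq_inv_mul]
  · rintro ⟨x, hx⟩
    obtain ⟨γ, hγ, h⟩ := exists_twist_eq_trivialQuartic (disc_quarticOfPoint_ne_zero hΔ hPE)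
      (x := x) (y := 1) (Or.inr one_ne_zero) hx
    rw [hIP, hJP] at h
    exact ⟨γ, hγ, by rw [← h, twist]⟩

/-- **Bhargava–Shankar, Lemma 5.10, the identity class: `f_P ∼ f_O` iff `P ∈ 2E_{I,J}(K)`**
(with `∃ R, R + R = P`), over a field of characteristic `0`, for `4I³ − J² ≠ 0`.
[cite: BhargavaShankarAnnals2015, Lemma 5.10 (arXiv:1006.1002v2 numbering)] -/
theorem pgl2Equiv_trivialQuartic_iff_exists_add_self_eq {I J ξ η : K} (hΔ : 4 * I ^ 3 - J ^ 2 ≠ 0)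
    (hP : (curveOfInvariants K I J).toAffine.Nonsingular ξ η) :
    PGL2Equiv (quarticOfPoint I ξ η) (trivialQuartic I J) ↔
      ∃ R : (curveOfInvariants K I J).toAffine.Point, R + R = .some _ _ hP := by
  rw [pgl2Equiv_trivialQuartic_iff_exists_root hΔ hP.1]
  constructor
  · rintro ⟨x, hx⟩
    exact exists_add_self_eq_of_eval_eq_zero hΔ hP hx
  · rintro ⟨R, hR⟩
    exact eval_eq_zero_of_add_self_eq hP hR

/-- **Bhargava–Shankar, Lemma 5.10, the identity class**, with `2E(K)` written as the range of
multiplication by `2` (the subgroup appearing in `Literature.NumberTheory.EllipticCurves.localSelmerRatio`):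
`f_P ∼ f_O` iff `P ∈ 2E_{I,J}(K)`. [cite: BhargavaShankarAnnals2015, Lemma 5.10 (arXiv:1006.1002v2 numbering)] -/
theorem pgl2Equiv_trivialQuartic_iff_mem_range_two {I J ξ η : K} (hΔ : 4 * I ^ 3 - J ^ 2 ≠ 0)
    (hP : (curveOfInvariants K I J).toAffine.Nonsingular ξ η) :
    PGL2Equiv (quarticOfPoint I ξ η) (trivialQuartic I J) ↔
      (.some _ _ hP : (curveOfInvariants K I J).toAffine.Point) ∈
        (zsmulAddGroupHom (α := (curveOfInvariants K I J).toAffine.Point) 2).range := by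
  rw [pgl2Equiv_trivialQuartic_iff_exists_add_self_eq hΔ hP, AddMonoidHom.mem_range]
  constructor
  · rintro ⟨R, hR⟩
    exact ⟨R, by rw [zsmulAddGroupHom_apply, two_zsmul, hR]⟩
  · rintro ⟨R, hR⟩
    exact ⟨R, by rw [← two_zsmul, ← zsmulAddGroupHom_apply]; exact hR⟩

end BinaryQuartic

end Literature.NumberTheory.EllipticCurves

end
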